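import Summits.QuantumFields.YangMills.Theorems.UnitScaleTiltProp7SectET3DeltaOneT3PInv
import HarnessLib

/-!
# Route `UnitScaleTilt`, crux «MinimiserStabilityRegPr» (stmt-QuantumFields-19200, stub EX) ∕ (O″χ) B0 (stmt-QuantumFields-20520), node N06(d = 3), route (α) —
# LAYER 0 BRICK L0b PART 4″ «PINV TWIN, Δ₁ GLUE ROWS» (def-free sequel of ✓p668391 `…SectET3DeltaOneT3PInv`):
# **THE J-TERM API AT THE PINV LETTERS** — the §3 «Glue» rows of ✓`…SectET3DeltaOneT3JTerm` (`H46L_apply`, `tjForm_apply`, `tjSesq_apply`, `inner_TJ_left`, `TJSlot_apply`,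
# `DeltaOneJ_def`, `inner_DeltaOneJ`, `tjForm_eq_zero_of_actionGrad_eq_zero`, `TJ_eq_zero_of_actionGrad_eq_zero`, `DeltaOneJ_apply_eq_DeltaPi_of_actionGrad_eq_zero`)
# RE-LETTERED VERBATIM for `H46LP tjFormP tjSesqP TJP TJSlotP DeltaOnePJ` (✓p668391) over `gaugeCorrP DeltaPiSlotP H46P` (✓p667715), plus the two NAMED specialisations
# `DeltaOnePJ_kills_NS (ha)` ∕ `inner_DL2_DeltaOnePJ_eq_zero (ha)` of ✓p668391's slot rows at `TJ := TJSlotP` (the `hkill`∕`horth` of the generic-slot suppliers at `Δx := DeltaOnePJ`)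

Cell `ym3-torus` (HUMAN RULING D-0037, YM ladder rung R3 — YM₃ on T³, NOT d = 4, NOT Clay; YM gap NOT proved).  Width seat `ym3-torus-px16` (gen 2); consumer of record:
★px21 g2's (r79) `h79`-member at `Δ₁ᴾ` («the tree's J-term letter IS lit's `−2⟨J, H̃ quadPart C̃ Y⟩` on Landau Hermitian `Y`» needs `inner_DeltaOnePJ` + `tjSesqP_apply` +
`tjFormP_apply` at the pinv letters), and S9′∕S9″ (★w2-19200 g6).

WHAT IS PROVED (def-free; every row is a definitional unfolding or a one-line rewrite — NO estimate, NO positivity, nothing about `PosOnto`):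
`H46LP_apply` · ★`tjFormP_apply : tjFormP U₀ X Y = −actionGrad U₀ (H46P U₀ (avgHess U₀ X Y))` · `tjSesqP_apply` · ★`inner_TJP_left : ⟪T_Jᴾ v, w⟫ = tjSesqP U₀ v w` · `TJSlotP_apply` ·
`DeltaOnePJ_def` · `DeltaOnePJ_apply` · ★★`inner_DeltaOnePJ : ⟪A′, Δ₁ᴾA⟫ = ⟪PᴾA′, Δ^η(PᴾA)⟫ + conj (tjSesqP U₀ (PᴾA) (PᴾA′))` · ★`DeltaOnePJ_kills_NS (ha : 0 ≤ a)` ·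
★`inner_DL2_DeltaOnePJ_eq_zero (ha)` · `tjFormP_eq_zero_of_actionGrad_eq_zero` · ★`TJP_eq_zero_of_actionGrad_eq_zero` · ★`DeltaOnePJ_apply_eq_DeltaPiSlotP_of_actionGrad_eq_zero`
(at a CRITICAL background `J(U₀) = 0` the J-term vanishes and `Δ₁ᴾ = Δ_πᴾ` pointwise — print p. 421 «for J = 0 we get the operators of Sect. … (G₀ = G)»).
HONEST SCOPE.  Linear-algebra glue only; the HONESTY CLAUSE + KILL CRITERION of the (C2′) pinv letters are those of ✓p667715's docstring; not a proof of any stub; nothing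
continuum ∕ OS ∕ mass-gap ∕ Clay.

References: T. Bałaban, *Propagators and renormalization transformations for lattice gauge theories. II*, CMP **99** (1985) 389–434 [Balaban1985BackgroundPropagators]
((3.119) p.419, (3.126) p.420, (3.127)–(3.130) p.421).
-/

set_option autoImplicit false

noncomputable section

open scoped InnerProductSpace ComplexConjugate Matrix.Norms.L2Operator

namespace Summit.QuantumFields.YangMills.Theorems.Prop7SectET3DeltaOnePInv

open Literature.MathematicalPhysics.QuantumFieldTheory.Balaban1983to89
open Literature.MathematicalPhysics.QuantumFieldTheory.Balaban1983to89.T3ContinuumYM3Torus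
open T3SectALandauChart (eta)
open B9SectCLatticeCarrier (Bond)
open B9Eq311L2Pairing (WL2)
open B11Eq103H1Complex (SiteL2K BondL2K)
open Summit.QuantumFields.YangMills.Theorems.Prop7SectET3Transport (periodsT3)
open Summit.QuantumFields.YangMills.Theorems.Prop7SectET3HilbertLetters (W₂ toL2 toL2B DL2 DstarL2)
open Summit.QuantumFields.YangMills.Theorems.Prop7SectET3GaugeProjector (NS RS)
open Summit.QuantumFields.YangMills.Theorems.Prop7SectET3WilsonHessian (DeltaEta toL2CLM)
open Summit.QuantumFields.YangMills.Theorems.Prop7SectET3DeltaOne (actionGrad avgHess)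
open Summit.QuantumFields.YangMills.Theorems.Prop7SectET3DeltaPiPInv (gaugeCorrP DeltaPiSlotP H46P gaugeCorrP_DL2_of_mem_NS)

variable {F : T3Family} {n K : ℕ} {h : n ≤ K} {c₀ cB a : ℝ} [Fact (0 < c₀)] [Fact (0 < cB)]

/-! ## §1 Unfoldings of the J-term letters at the pinv slot -/

section Glue

/-- `H46LP` is `H46P`. [cite: Balaban1985BackgroundPropagators, (3.126) p.420] -/
theorem H46LP_apply (U₀ : GaugeField (F.P K) 0 (Matrix.specialUnitaryGroup (Fin 2) ℂ)) (Y : PBond (F.P n) 0 → Matrix (Fin 2) (Fin 2) ℂ) :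
    H46LP F n K h c₀ cB a U₀ Y = H46P F n K h c₀ cB a U₀ Y := rfl

/-- ★ **THE J-TERM FORMULA AT THE PINV LETTER: `t_Jᴾ[X, Y] = −actionGrad (H46P (avgHess X Y))`** (print's `−2⟨HC⁽²⁾(A), J⟩`, polarised; twin of ✓`tjForm_apply`).
[cite: Balaban1985BackgroundPropagators, (3.127) p.421] -/
theorem tjFormP_apply (U₀ : GaugeField (F.P K) 0 (Matrix.specialUnitaryGroup (Fin 2) ℂ)) (X Y : PBond (F.P K) 0 → Matrix (Fin 2) (Fin 2) ℂ) :
    tjFormP F n K h c₀ cB a U₀ X Y = -actionGrad F K U₀ (H46P F n K h c₀ cB a U₀ (avgHess F n K h U₀ X Y)) := by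
  simp [tjFormP, H46LP]

/-- Unfolding the sesquilinear form at the pinv letter: `tjSesqP U₀ v w = (−2c₀∕η²) · t_Jᴾ[(toL2⁻¹ v)ᴴ, toL2⁻¹ w]` (twin of ✓`tjSesq_apply`). [cite: Balaban1985BackgroundPropagators, (3.127) p.421] -/
theorem tjSesqP_apply (U₀ : GaugeField (F.P K) 0 (Matrix.specialUnitaryGroup (Fin 2) ℂ)) (v w : BondL2K ℂ 3 (periodsT3 F K) c₀ W₂) :
    tjSesqP F n K h c₀ cB a U₀ v w =
      ((-(2 * (c₀ : ℂ)) / (((eta F n K : ℝ) : ℂ)) ^ 2)) * tjFormP F n K h c₀ cB a U₀ (star ((toL2 F K c₀).symm v)) ((toL2 F K c₀).symm w) := by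
  simp [tjSesqP, toL2CLM]

/-- ★ **THE DEFINING PROPERTY OF `T_Jᴾ(U₀)`: `⟪T_Jᴾ v, w⟫ = tjSesqP U₀ v w`** (twin of ✓`inner_TJ_left`). [cite: Balaban1985BackgroundPropagators, (3.127)–(3.128) p.421] -/
theorem inner_TJP_left (U₀ : GaugeField (F.P K) 0 (Matrix.specialUnitaryGroup (Fin 2) ℂ)) (v w : BondL2K ℂ 3 (periodsT3 F K) c₀ W₂) :
    ⟪TJP F n K h c₀ cB a U₀ v, w⟫_ℂ = tjSesqP F n K h c₀ cB a U₀ v w :=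
  InnerProductSpace.continuousLinearMapOfBilin_apply (tjSesqP F n K h c₀ cB a U₀) v w

/-- Unfolding the slot (twin of ✓`TJSlot_apply`). [cite: Balaban1985BackgroundPropagators, (3.128) p.421] -/
theorem TJSlotP_apply (U₀ : GaugeField (F.P K) 0 (Matrix.specialUnitaryGroup (Fin 2) ℂ)) (v : BondL2K ℂ 3 (periodsT3 F K) c₀ W₂) :
    TJSlotP F n K h c₀ cB a U₀ v = TJP F n K h c₀ cB a U₀ v := rfl

/-- `Δ₁ᴾ` of record is ✓`DeltaOneP` at the J-term of record (twin of ✓`DeltaOneJ_def`). [cite: Balaban1985BackgroundPropagators, (3.128) p.421] -/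
theorem DeltaOnePJ_def : DeltaOnePJ F n K h c₀ cB a = DeltaOneP F n K h c₀ cB a (TJSlotP F n K h c₀ cB a) := rfl

/-- Unfolding `Δ₁ᴾ = Pᴾᵀ(Δ^η + T_Jᴾ)Pᴾ` at the J-term of record. [cite: Balaban1985BackgroundPropagators, (3.128) p.421] -/
theorem DeltaOnePJ_apply (U₀ : GaugeField (F.P K) 0 (Matrix.specialUnitaryGroup (Fin 2) ℂ)) (A : BondL2K ℂ 3 (periodsT3 F K) c₀ W₂) :
    DeltaOnePJ F n K h c₀ cB a U₀ A =
      LinearMap.adjoint (gaugeCorrP F n K h c₀ cB a U₀)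
        (DeltaEta F n K c₀ U₀ (gaugeCorrP F n K h c₀ cB a U₀ A) + TJP F n K h c₀ cB a U₀ (gaugeCorrP F n K h c₀ cB a U₀ A)) := rfl

/-- ★★ **(3.128) AS A FORM AT THE J-TERM OF RECORD, PINV LETTERS: `⟪A′, Δ₁ᴾA⟫ = ⟪PᴾA′, Δ^η(PᴾA)⟫ + conj (tjSesqP (PᴾA) (PᴾA′))`** (twin of ✓`inner_DeltaOneJ`).
[cite: Balaban1985BackgroundPropagators, (3.127)–(3.128) p.421] -/
theorem inner_DeltaOnePJ (U₀ : GaugeField (F.P K) 0 (Matrix.specialUnitaryGroup (Fin 2) ℂ)) (A' A : BondL2K ℂ 3 (periodsT3 F K) c₀ W₂) :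
    ⟪A', DeltaOnePJ F n K h c₀ cB a U₀ A⟫_ℂ =
      ⟪gaugeCorrP F n K h c₀ cB a U₀ A', DeltaEta F n K c₀ U₀ (gaugeCorrP F n K h c₀ cB a U₀ A)⟫_ℂ +
        conj (tjSesqP F n K h c₀ cB a U₀ (gaugeCorrP F n K h c₀ cB a U₀ A) (gaugeCorrP F n K h c₀ cB a U₀ A')) := by
  rw [DeltaOnePJ_def, inner_DeltaOneP, TJSlotP_apply, ← inner_conj_symm _ (TJP F n K h c₀ cB a U₀ _), inner_TJP_left]

/-- ★ **`hkill` AT `Δx := DeltaOnePJ`, BY NAME: `Δ₁ᴾ(D_{U₀}λ) = 0` for `λ ∈ N_S(U₀)`, `0 ≤ a`** (✓`DeltaOneP_kills_NS` at `TJ := TJSlotP`).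
[cite: Balaban1985BackgroundPropagators, (3.124) p.420, (3.128) p.421] -/
theorem DeltaOnePJ_kills_NS (ha : 0 ≤ a) {U₀ : GaugeField (F.P K) 0 (Matrix.specialUnitaryGroup (Fin 2) ℂ)} :
    ∀ l ∈ NS F n K h c₀ cB U₀, DeltaOnePJ F n K h c₀ cB a U₀ (DL2 F n K c₀ U₀ l) = 0 :=
  DeltaOneP_kills_NS (TJSlotP F n K h c₀ cB a) ha

/-- ★ **`horth` AT `Δx := DeltaOnePJ`, BY NAME: `⟪Dλ, Δ₁ᴾw⟫ = 0` on `N_S`, `0 ≤ a`** (✓`inner_DL2_DeltaOneP_eq_zero` at `TJ := TJSlotP`).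
[cite: Balaban1985BackgroundPropagators, (3.119) p.419, (3.128) p.421] -/
theorem inner_DL2_DeltaOnePJ_eq_zero (ha : 0 ≤ a) {U₀ : GaugeField (F.P K) 0 (Matrix.specialUnitaryGroup (Fin 2) ℂ)} :
    ∀ l ∈ NS F n K h c₀ cB U₀, ∀ w, ⟪DL2 F n K c₀ U₀ l, DeltaOnePJ F n K h c₀ cB a U₀ w⟫_ℂ = 0 :=
  inner_DL2_DeltaOneP_eq_zero (TJSlotP F n K h c₀ cB a) ha

/-! ### At a critical background the J-term vanishes and `Δ₁ᴾ = Δ_πᴾ` there -/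

/-- `J = 0 ⇒ t_Jᴾ = 0` (twin of ✓`tjForm_eq_zero_of_actionGrad_eq_zero`). [cite: Balaban1985BackgroundPropagators, (3.127) p.421] -/
theorem tjFormP_eq_zero_of_actionGrad_eq_zero {U₀ : GaugeField (F.P K) 0 (Matrix.specialUnitaryGroup (Fin 2) ℂ)} (hJ : actionGrad F K U₀ = 0) :
    tjFormP F n K h c₀ cB a U₀ = 0 := by
  ext X Y
  rw [tjFormP_apply, hJ, zero_apply, neg_zero, zero_apply, zero_apply]

/-- ★ **AT A CRITICAL BACKGROUND (`J(U₀) = 0`) THE J-TERM OPERATOR AT THE PINV LETTER VANISHES: `T_Jᴾ(U₀) = 0`** (twin of ✓`TJ_eq_zero_of_actionGrad_eq_zero`).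
[cite: Balaban1985BackgroundPropagators, (3.127) p.421] -/
theorem TJP_eq_zero_of_actionGrad_eq_zero {U₀ : GaugeField (F.P K) 0 (Matrix.specialUnitaryGroup (Fin 2) ℂ)} (hJ : actionGrad F K U₀ = 0) :
    TJP F n K h c₀ cB a U₀ = 0 := by
  refine ContinuousLinearMap.ext fun v => ext_inner_right ℂ fun w => ?_
  rw [inner_TJP_left, tjSesqP_apply, tjFormP_eq_zero_of_actionGrad_eq_zero hJ, zero_apply, zero_apply, mul_zero,
    zero_apply, inner_zero_left]

/-- ★ … hence **`Δ₁ᴾ(U₀) = Δ_πᴾ(U₀)` at a critical background** (✓`DeltaOneP_zero` pointwise; twin of ✓`DeltaOneJ_apply_eq_DeltaPi_of_actionGrad_eq_zero`; print p. 421 «for J = 0 we get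
the operators of Sect. … (G₀ = G)»). [cite: Balaban1985BackgroundPropagators, (3.128)–(3.130) p.421, (3.119) p.419] -/
theorem DeltaOnePJ_apply_eq_DeltaPiSlotP_of_actionGrad_eq_zero {U₀ : GaugeField (F.P K) 0 (Matrix.specialUnitaryGroup (Fin 2) ℂ)} (hJ : actionGrad F K U₀ = 0)
    (A : BondL2K ℂ 3 (periodsT3 F K) c₀ W₂) :
    DeltaOnePJ F n K h c₀ cB a U₀ A = DeltaPiSlotP F n K h c₀ cB a U₀ A := by
  rw [DeltaOnePJ_apply, TJP_eq_zero_of_actionGrad_eq_zero hJ, zero_apply, add_zero]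
  rfl

end Glue

end Summit.QuantumFields.YangMills.Theorems.Prop7SectET3DeltaOnePInv

end
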